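import Summits.BirchSwinnertonDyer.BirchSwinnertonDyer.Theses.ByReductionTypeAtTwo
import Summits.BirchSwinnertonDyer.BirchSwinnertonDyer.Theses.TwoAdicConverse
import Summits.BirchSwinnertonDyer.BirchSwinnertonDyer.Theorems.ByReductionTypeAtTwoKatoFreeSandwichAssembly

/-! # crux-triage r1 seat 1, GEN 16 probe — P3″ AS RENDERED (K4 rev 26, commit 9a9183355f07, 2026-08-28T22:52Z)

(Q16) The rendered `--split` of crux 203 `OrdMissingLowerBoundAtTwo` (stmt-19577) into the support child stmt-23764
`OrdMLBPrintBundleAtTwo` (PUB ∧ Cassels ∧ AU ∧ T2, by name), the crux child `ByReductionTypeAtTwo.OrdLambdaHalfAtTwo`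
(= stmt-19556) and the glue stmt-23765 `OrdMissingLowerBoundAtTwoOfChildren`, checked from the TREE decls (not the pen's text copies):
* `child_iff_S3`, `child_iff_theorems` — the K4 child text IS S3's route decl and the Theorems constant (`Iff.rfl`): signature dedup holds;
* `glue_closes` — the glue item holds BY NAME, one application of p668589
  `KatoFreeSandwich.ordMissingLowerBoundAtTwo_of_published_of_lambdaHalf`;
* `parent_of_children` — hypotheses-first restatement: bundle ∧ 19556 ⟹ crux 203.
FARM (this seat, 2026-08-28T23:0xZ): rc 0, 0 errors, 0 sorries, `#print axioms glue_closes` = {propext, Classical.choice, Quot.sound}.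
Kernel facts only.  BSD is not proved; crux 203 / stmt-19577 is NOT closed by this file (the print bundle and stmt-19556 remain
hypotheses).  Not a landing: the glue closer `Theorems/ByReductionTypeAtTwoOrdMissingLowerBoundAtTwoOfChildren.lean` is a K4-ACL
prover's by-name filing; this probe only certifies, independently of the pen certificate, that the RENDERED decls admit it. -/

set_option linter.dupNamespace false

namespace Summit.BirchSwinnertonDyer.BirchSwinnertonDyer.Cruxes.OrdMissingLowerBoundAtTwo.TriageR1Seat1.P3SplitRendered

open Summit.BirchSwinnertonDyer.BirchSwinnertonDyer

/-- dedup: the K4 crux child's text is S3's item stmt-19556 verbatim. -/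
theorem child_iff_S3 :
    Theses.ByReductionTypeAtTwo.OrdLambdaHalfAtTwo ↔ Theses.TwoAdicConverse.OrdLambdaHalfAtTwo := Iff.rfl

/-- dedup: … and is the Theorems constant consumed by p668589. -/
theorem child_iff_theorems :
    Theses.ByReductionTypeAtTwo.OrdLambdaHalfAtTwo ↔ Theorems.TwoAdicTwistConverse.OrdLambdaHalfAtTwo := Iff.rfl

/-- the glue item stmt-23765, BY NAME, from the rendered tree decls: one application of p668589. -/
theorem glue_closes : Theses.ByReductionTypeAtTwo.OrdMissingLowerBoundAtTwoOfChildren := by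
  intro hB hLam
  obtain ⟨hPub, hCas, hAU, hT2⟩ := hB
  exact Theorems.KatoFreeSandwich.ordMissingLowerBoundAtTwo_of_published_of_lambdaHalf hPub hCas hAU hT2 hLam

/-- hypotheses-first restatement: the print bundle and S3's stmt-19556 give crux 203 (stmt-19577). -/
theorem parent_of_children (hB : Theses.ByReductionTypeAtTwo.OrdMLBPrintBundleAtTwo)
    (hLam : Theses.TwoAdicConverse.OrdLambdaHalfAtTwo) :
    Theses.ByReductionTypeAtTwo.OrdMissingLowerBoundAtTwo :=
  glue_closes hB (child_iff_S3.mpr hLam)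

end Summit.BirchSwinnertonDyer.BirchSwinnertonDyer.Cruxes.OrdMissingLowerBoundAtTwo.TriageR1Seat1.P3SplitRendered
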